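import Literature.Probability.RandomPlanarGeometry.SLERestrictionLocalMartingaleKappa
import Literature.Probability.RandomPlanarGeometry.SLERestrictionMartingaleKappa
import Literature.Probability.RandomPlanarGeometry.SLERestrictionMartingaleExists
import Literature.Probability.Process.NestedStoppedMartingales
import Literature.Probability.Process.MartingaleLimit
import HarnessLib

/-!
# The compensated restriction martingale of [LSW] Prop. 5.3 (`0 < κ ≤ 8/3`) exists

General-`κ` twin of `SLERestrictionConvergence` + `SLERestrictionMartingaleExists` (the case
`κ = 8/3`, `α = 5/8`, `λ = 0`), after G. F. Lawler, O. Schramm, W. Werner, *Conformal restriction: the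
chordal case* (2003) (**[LSW]**), §5 Prop. 5.3 ("`Y_t = h_t′(W_t)^α exp(λ ∫₀ᵗ Sh_s(W_s)/6 ds)`,
`t < T`, … If `κ ≤ 8/3`, then `Y_t` is a bounded martingale") and the martingale convergence step
of the proofs of Thm. 6.1/6.5 ("the a.s. limit `Y_T := lim_{t ↗ T} Y_t` exists").

From the localised martingales `Mⁿ = Ỹ^{Tₙ}` of `SLERestrictionLocalMartingaleKappa`:

* `IpK`, `YprocK` — the unstopped compensator `∫₀ᵗ 𝟙{alive} m(A_s − W_s) ds` and the process
  `Y_t = (Φ′ 𝟙{alive})_t^α e^{−λ ∫₀ᵗ m}`, bounded by `1`; `stoppedProcess_YprocK_eq_locMartK` —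
  `Y^{Tₖ} = Mᵏ` once `Tₖ > 0` (`exists_forall_locTimeK_pos`), so every `Y^{Tₖ}` is a martingale with
  continuous paths; `monotone_locTimeK`; `disjoint_closedHull_iff_exists_lt_locTimeK` — the alive
  times are `⋃ₖ [0, Tₖ)`; `ae_cauchy_stoppedProcess_YprocK` — a.s. uniform Cauchy property
  (`Process.ae_nested_stoppedProcess_cauchy`);
* `YbarK` — the limit process, a `[0, 1]`-valued martingale (`martingale_YbarK`), equal to `Y` while
  alive, frozen at the terminal time (`exists_frozen_of_cauchyK`);
* `LpK` — the compensator as a monotone `[0, ∞]`-valued family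
  `L_t = ∫⁻_{(0,t]} 𝟙{alive} m(A_s − W_s) ds`, with `e^{−λ ∫₀ᵗ m} = compFactor (λ L_t)` while alive;
* **`isRestrictionMartingaleK_YbarK`**, **`exists_isRestrictionMartingaleK`** — for `0 < κ ≤ 8/3` and
  every nonempty `A ∈ 𝒬*`, `(LpK, YbarK)` satisfies the specification `IsRestrictionMartingaleK κ α λ A`
  of `SLERestrictionMartingaleKappa`, the hitting time of the SLE_κ trace being identified with the
  death time of the hulls through the Rohde–Schramm trace theorems (simple curve, `κ ≤ 4`).

## References

* [LSW] Prop. 5.3 (§5), proofs of Thm. 6.1 and Thm. 6.5 (§6). [LawlerSchrammWerner2003Restriction]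
* D. Revuz, M. Yor, *Continuous Martingales and Brownian Motion* (1999), Ch. II Thm (2.10).
* S. Rohde, O. Schramm, *Basic properties of SLE* (2005), Thm 5.1, Thm 6.1. [RohdeSchramm2005]
-/

noncomputable section

open Set Filter Metric Function MeasureTheory ProbabilityTheory
open _root_.Complex _root_.Topology
open Literature.Probability.Process (brownian preWienerMeasure)
open Literature.Analysis.FunctionSpaces (timeIntegral)
open scoped NNReal ENNReal

namespace Literature.Probability.RandomPlanarGeometry

open Loewner PathOps

section Nesting

variable {κ : ℝ≥0} {α lam : ℝ} {A : Set ℂ} {hA : IsStarHull A} {hne : A.Nonempty}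

variable (κ) in
/-- **The unstopped compensator `I_t = ∫₀ᵗ 𝟙{alive} m(A_s − W_s) ds`** (Bochner time integral; the
genuine integral before the death time, where the mass is locally bounded).
[cite: LawlerSchrammWerner2003Restriction, Prop. 5.3 (the compensator)] -/
def IpK (A : Set ℂ) : ℝ≥0 → (ℝ≥0 → ℝ) → ℝ := timeIntegral (MpK κ A)

variable (κ α lam) in
/-- **The process `Y_t = (Φ′_{A_t − W_t}(0) 𝟙{alive})^α e^{−λ I_t}`.** [cite: LawlerSchrammWerner2003Restriction, Prop. 5.3 (Y_t)] -/
def YprocK (A : Set ℂ) (t : ℝ≥0) (ω : ℝ≥0 → ℝ) : ℝ :=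
  DFnK κ A t (brownianCPath ω) ^ α * Real.exp (-(lam * IpK κ A t ω))

/-- `I_t ≥ 0`. [folklore] -/
theorem IpK_nonneg (hA : IsStarHull A) (t : ℝ≥0) (ω : ℝ≥0 → ℝ) : 0 ≤ IpK κ A t ω :=
  intervalIntegral.integral_nonneg t.coe_nonneg fun _ _ ↦ MpK_nonneg hA _ _

/-- `0 ≤ Y ≤ 1` (for `α > 0`, `λ ≥ 0`). [folklore] -/
theorem YprocK_mem_Icc (hA : IsStarHull A) (hα : 0 < α) (hlam : 0 ≤ lam) (t : ℝ≥0) (ω : ℝ≥0 → ℝ) :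
    YprocK κ α lam A t ω ∈ Icc (0 : ℝ) 1 := by
  obtain ⟨-, -, h0, h1⟩ := DFnK_eq (κ := κ) (A := A) t (brownianCPath ω)
  have e0 : 0 ≤ DFnK κ A t (brownianCPath ω) ^ α := Real.rpow_nonneg h0 _
  have e1 : DFnK κ A t (brownianCPath ω) ^ α ≤ 1 := Real.rpow_le_one h0 h1 hα.le
  have c0 : 0 < Real.exp (-(lam * IpK κ A t ω)) := Real.exp_pos _
  have c1 : Real.exp (-(lam * IpK κ A t ω)) ≤ 1 := by
    rw [Real.exp_le_one_iff, neg_nonpos]; exact mul_nonneg hlam (IpK_nonneg hA t ω)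
  exact ⟨mul_nonneg e0 c0.le, mul_le_one₀ e1 c0.le c1⟩

/-- `|Y| ≤ 1`. [folklore] -/
theorem abs_YprocK_le (hA : IsStarHull A) (hα : 0 < α) (hlam : 0 ≤ lam) (t : ℝ≥0) (ω : ℝ≥0 → ℝ) :
    |YprocK κ α lam A t ω| ≤ 1 := by
  rw [abs_of_nonneg (YprocK_mem_Icc hA hα hlam t ω).1]; exact (YprocK_mem_Icc hA hα hlam t ω).2

/-! ### Monotonicity of the localising times -/

/-- `D̂ⁿ ≤ D̂ᵐ` for `n ≤ m`. [folklore] -/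
theorem DhatpK_mono {n m : ℕ} (hnm : n ≤ m) (t : ℝ≥0) (ω : ℝ≥0 → ℝ) :
    DhatpK κ hA hne n t ω ≤ DhatpK κ hA hne m t ω := by
  simp only [DhatpK, DhatFnK]
  exact min_le_min le_rfl (mul_le_mul_of_nonneg_right (by exact_mod_cast hnm) (RFnK_nonneg _ _))

/-- **`T₀ ≤ T₁ ≤ ⋯`** (smaller levels and larger `D̂` are hit later). [folklore] -/
theorem monotone_locTimeK (ω : ℝ≥0 → ℝ) : Monotone fun k ↦ locTimeK κ hA hne k ω := by
  refine monotone_nat_of_le_succ fun k ↦ ?_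
  obtain ⟨hRc, -⟩ := continuous_RpK_DhatpK (κ := κ) (hA := hA) (hne := hne) 0 ω
  have hDc := fun j ↦ (continuous_RpK_DhatpK (κ := κ) (hA := hA) (hne := hne) j ω).2
  have hlev := locLevel_anti (Nat.le_succ k)
  refine min_le_min (min_le_min ?_ ?_) (by push_cast; exact_mod_cast (le_self_add : (k : ℝ≥0) + 1 ≤ (k : ℝ≥0) + 1 + 1))
  · exact hittingAfter_le_hittingAfter isClosed_Iic isClosed_Iic hRc hRc fun t ht ↦ (mem_Iic.1 ht).trans hlev
  · exact hittingAfter_le_hittingAfter isClosed_Iic isClosed_Iic (hDc _) (hDc _) fun t ht ↦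
      ((DhatpK_mono (Nat.le_succ (k + 1)) t ω).trans (mem_Iic.1 ht)).trans hlev

/-! ### The values at time `0`, and positivity of `Tₖ` for large `k` -/

/-- At time `0` the slid hull is `A`. [folklore] -/
theorem slidHull_drvK_zero (hA : IsStarHull A) (υ : C(ℝ≥0, ℝ)) : slidHull (drvK κ υ) A 0 = A := by
  rw [slidHull_zero (continuous_drvK κ υ) (by rw [drvK_zero, Complex.ofReal_zero]; exact hA.zero_notMem), drvK_zero]
  simp

/-- **The values at time `0` are deterministic**: `R_0 = min dist(0, A) 1`,
`D̂ⁿ_0 = min Φ'_A(0) (n R_0)`. [folklore] -/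
theorem RpK_DhatpK_zero (hA : IsStarHull A) (hne : A.Nonempty) (n : ℕ) (ω : ℝ≥0 → ℝ) :
    RpK κ hA hne 0 ω = min (infDist 0 A) 1 ∧ DhatpK κ hA hne n 0 ω = min (starDeriv A) (n * min (infDist 0 A) 1) := by
  have halive := disjoint_closedHull_zeroK (κ := κ) (A := A) hA (brownianCPath ω)
  have hR : RpK κ hA hne 0 ω = min (infDist 0 A) 1 := by
    obtain ⟨s₀, hs₀, -, heq⟩ := exists_aliveFn_eq_min (W := fun υ : C(ℝ≥0, ℝ) ↦ drvK κ υ) (continuous_drvK κ _) hA hne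
      (denseSeq_spec hA hne).1 (denseSeq_spec hA hne).2 halive
    have : s₀ = 0 := le_antisymm hs₀ bot_le
    rw [this, slidHull_drvK_zero hA] at heq
    exact heq
  refine ⟨hR, ?_⟩
  rw [DhatpK, DhatFnK, (DFnK_eq (κ := κ) (A := A) 0 (brownianCPath ω)).1 halive, slidHull_drvK_zero hA]
  congr 1
  change (n : ℝ) * RpK κ hA hne 0 ω = _
  rw [hR]

/-- **`Tₖ > 0` for all paths once `k` is large** (the time-`0` values are deterministic and positive).
[folklore] -/
theorem exists_forall_locTimeK_pos (hA : IsStarHull A) (hne : A.Nonempty) :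
    ∃ k₀ : ℕ, ∀ k, k₀ ≤ k → ∀ ω, (0 : WithTop ℝ≥0) < locTimeK κ hA hne k ω := by
  obtain ⟨hm0, -⟩ := infDist_zero_pos hA hne
  obtain ⟨hd0, -, -⟩ := starDeriv_spec hA
  set r₀ : ℝ := min (infDist 0 A) 1 with hr₀
  have hr₀0 : 0 < r₀ := lt_min hm0 one_pos
  set θ : ℝ := min r₀ (starDeriv A) with hθ
  have hθ0 : 0 < θ := lt_min hr₀0 hd0
  obtain ⟨k₀, hk₀⟩ := exists_nat_gt (1 / θ + 1 / r₀)
  refine ⟨k₀, fun k hk ω ↦ ?_⟩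
  have hk' : (1 / θ + 1 / r₀ : ℝ) < k := hk₀.trans_le (by exact_mod_cast hk)
  have hck : locLevel k < θ := by
    rw [locLevel, div_lt_iff₀ (by positivity)]
    have h1 : 1 / θ < k := by have := one_div_pos.2 hr₀0; linarith
    rw [div_lt_iff₀ hθ0] at h1; nlinarith
  have hck' : locLevel k < (k + 1 : ℕ) * r₀ := by
    rw [locLevel]
    have h1 : 1 / r₀ < k := by have := one_div_pos.2 hθ0; linarith
    rw [div_lt_iff₀ hr₀0] at h1
    have hc1 : 1 / ((k : ℝ) + 1) ≤ 1 := by rw [div_le_one (by positivity)]; linarith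
    push_cast; nlinarith
  obtain ⟨hR0, hD0⟩ := RpK_DhatpK_zero (κ := κ) hA hne (k + 1) ω
  obtain ⟨hRc, -⟩ := continuous_RpK_DhatpK (κ := κ) (hA := hA) (hne := hne) 0 ω
  have hDc := (continuous_RpK_DhatpK (κ := κ) (hA := hA) (hne := hne) (k + 1) ω).2
  rw [locTimeK]
  refine lt_min (lt_min ?_ ?_) (by exact_mod_cast (show (0 : ℝ≥0) < (k : ℝ≥0) + 1 by positivity))
  · by_contra hle
    rw [not_lt, ← WithTop.coe_zero, Process.hittingAfter_zero_le_coe_iff isClosed_Iic hRc] at hle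
    obtain ⟨j, hj, hjs⟩ := hle
    have : j = 0 := le_antisymm hj bot_le
    rw [this, mem_Iic, hR0] at hjs
    have := min_le_left r₀ (starDeriv A)
    linarith
  · by_contra hle
    rw [not_lt, ← WithTop.coe_zero, Process.hittingAfter_zero_le_coe_iff isClosed_Iic hDc] at hle
    obtain ⟨j, hj, hjs⟩ := hle
    have : j = 0 := le_antisymm hj bot_le
    rw [this, mem_Iic, hD0] at hjs
    rcases min_cases (starDeriv A) (((k + 1 : ℕ) : ℝ) * min (infDist 0 A) 1) with ⟨h1, -⟩ | ⟨h1, -⟩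
    · rw [h1] at hjs; have := min_le_right r₀ (starDeriv A); linarith
    · rw [h1] at hjs; linarith

/-! ### `Y^{Tₖ} = Mᵏ` -/

/-- **Before `Tₖ` the stopped compensator is the unstopped one.** [folklore] -/
theorem IpnK_eq_IpK_of_le {k : ℕ} {r : ℝ≥0} {ω : ℝ≥0 → ℝ} (hr : (r : WithTop ℝ≥0) ≤ locTimeK κ hA hne k ω) :
    IpnK κ hA hne k r ω = IpK κ A r ω := by
  show ∫ s in (0 : ℝ)..(r : ℝ), Literature.Analysis.FunctionSpaces.trunc (locTimeK κ hA hne k) (MpK κ A) s.toNNReal ω =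
    ∫ s in (0 : ℝ)..(r : ℝ), MpK κ A s.toNNReal ω
  refine intervalIntegral.integral_congr fun s hs ↦ ?_
  rw [Set.uIcc_of_le r.coe_nonneg] at hs
  have hsr : s.toNNReal ≤ r := Real.toNNReal_le_iff_le_coe.2 hs.2
  have hle : ((s.toNNReal : ℝ≥0) : WithTop ℝ≥0) ≤ locTimeK κ hA hne k ω := (WithTop.coe_le_coe.2 hsr).trans hr
  simp only [Literature.Analysis.FunctionSpaces.trunc_apply, if_pos hle]

/-- **The stopped process `Y^{Tₖ}` is the localised martingale `Mᵏ`** whenever `Tₖ > 0` everywhere.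
[folklore] -/
theorem stoppedProcess_YprocK_eq_locMartK {k : ℕ} (hk : ∀ ω, (0 : WithTop ℝ≥0) < locTimeK κ hA hne k ω) :
    stoppedProcess (YprocK κ α lam A) (locTimeK κ hA hne k) = locMartK κ α lam hA hne k := by
  funext t ω
  rw [locMartK, stoppedProcess, stoppedProcess, YprocK, YtilK]
  set r := (min (t : WithTop ℝ≥0) (locTimeK κ hA hne k ω)).untopA with hr
  have hrT : (r : WithTop ℝ≥0) ≤ locTimeK κ hA hne k ω := by
    rw [hr, Process.coe_untopA_min]; exact min_le_right _ _
  obtain ⟨halive, -, hDeq, -, -⟩ := controlled_of_le_locTimeK hrT (hk ω)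
  rw [hDeq, (DFnK_eq (κ := κ) (A := A) r (brownianCPath ω)).1 halive, IpnK_eq_IpK_of_le hrT]

/-- Every `Y^{Tₖ}` (large `k`) is a martingale with continuous paths. [folklore] -/
theorem martingale_stoppedProcess_YprocK (hκ0 : 0 < κ) (hκ : κ ≤ 8 / 3) (hαdef : α = (6 - κ) / (2 * κ))
    (hlamdef : lam = (8 - 3 * κ) * (6 - κ) / (2 * κ)) {k : ℕ} (hk : ∀ ω, (0 : WithTop ℝ≥0) < locTimeK κ hA hne k ω) :
    Martingale (stoppedProcess (YprocK κ α lam A) (locTimeK κ hA hne k)) brownianFiltration preWienerMeasure ∧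
      ∀ ω, Continuous fun t ↦ stoppedProcess (YprocK κ α lam A) (locTimeK κ hA hne k) t ω := by
  obtain ⟨hαpos, -⟩ := exponents_pos hκ hαdef hlamdef hκ0
  rw [stoppedProcess_YprocK_eq_locMartK hk]
  exact ⟨martingale_locMartK hκ0 hκ hαdef hlamdef, fun ω ↦ Process.continuous_stoppedProcess_path (continuous_YtilK hαpos ω) _⟩

/-! ### The alive times are `⋃ₖ [0, Tₖ)` -/

/-- **Alive at `t` iff `t < Tₖ` for some `k`.** [folklore] -/
theorem disjoint_closedHull_iff_exists_lt_locTimeK (t : ℝ≥0) (ω : ℝ≥0 → ℝ) :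
    Disjoint (closedHull (drvK κ (brownianCPath ω)) t) A ↔ ∃ k, (t : WithTop ℝ≥0) < locTimeK κ hA hne k ω := by
  constructor
  swap
  · rintro ⟨k, hk⟩
    exact (controlled_of_lt_locTimeK hk).1
  intro halive
  by_contra hnot
  push Not at hnot
  set W := drvK κ (brownianCPath ω) with hW
  have hWc : Continuous W := continuous_drvK κ _
  have hall : ∀ s ∈ Icc (0 : ℝ≥0) t, Disjoint (closedHull W s) A := fun s hs ↦ alive_mono hs.2 halive
  obtain ⟨hRc, -⟩ := continuous_RpK_DhatpK (κ := κ) (hA := hA) (hne := hne) 0 ω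
  obtain ⟨sR, hsR, hminR⟩ := isCompact_Icc.exists_isMinOn ⟨0, left_mem_Icc.2 bot_le⟩ (hRc.continuousOn (s := Icc (0 : ℝ≥0) t))
  have hμR : 0 < RpK κ hA hne sR ω := (RFnK_pos_iff sR (brownianCPath ω)).2 (hall sR hsR)
  have hdcont : ContinuousOn (fun s : ℝ≥0 ↦ starDeriv (slidHull W A s)) (Icc 0 t) := fun s hs ↦
    (continuousWithinAt_starDeriv_slidHull hWc hA hne (hall s hs)).mono fun s' hs' ↦ hall s' hs'
  obtain ⟨sd, hsd, hmind⟩ := isCompact_Icc.exists_isMinOn ⟨0, left_mem_Icc.2 bot_le⟩ hdcont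
  have hμd : 0 < starDeriv (slidHull W A sd) := (starDeriv_pos_le_one _).1
  set θ := min (RpK κ hA hne sR ω) (starDeriv (slidHull W A sd)) with hθ
  have hθ0 : 0 < θ := lt_min hμR hμd
  obtain ⟨k, hk⟩ := exists_nat_gt (1 / θ + (t : ℝ))
  have hck : locLevel k < θ := by
    rw [locLevel, div_lt_iff₀ (by positivity)]
    have h1 : 1 / θ < k := by have := t.coe_nonneg; linarith
    rw [div_lt_iff₀ hθ0] at h1; nlinarith
  have hkt : (t : ℝ) < k + 1 := by have := one_div_pos.2 hθ0; linarith
  have hle := hnot k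
  rw [locTimeK] at hle
  have hDc := (continuous_RpK_DhatpK (κ := κ) (hA := hA) (hne := hne) (k + 1) ω).2
  rcases min_le_iff.1 hle with h12 | h3
  · rcases min_le_iff.1 h12 with h1 | h2
    · obtain ⟨j, hj, hjs⟩ := (Process.hittingAfter_zero_le_coe_iff isClosed_Iic hRc).1 h1
      have e2 : RpK κ hA hne sR ω ≤ RpK κ hA hne j ω := hminR (show j ∈ Icc (0 : ℝ≥0) t from ⟨bot_le, hj⟩)
      rw [mem_Iic] at hjs
      have := min_le_left (RpK κ hA hne sR ω) (starDeriv (slidHull W A sd))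
      linarith
    · obtain ⟨j, hj, hjs⟩ := (Process.hittingAfter_zero_le_coe_iff isClosed_Iic hDc).1 h2
      rw [mem_Iic] at hjs
      have hjalive := hall j ⟨bot_le, hj⟩
      have hD : DhatpK κ hA hne (k + 1) j ω = min (starDeriv (slidHull W A j)) ((k + 1 : ℕ) * RpK κ hA hne j ω) := by
        rw [DhatpK, DhatFnK, (DFnK_eq (κ := κ) (A := A) j (brownianCPath ω)).1 hjalive]; rfl
      rw [hD] at hjs
      have e1 : starDeriv (slidHull W A sd) ≤ starDeriv (slidHull W A j) := hmind (show j ∈ Icc (0 : ℝ≥0) t from ⟨bot_le, hj⟩)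
      have e2 : RpK κ hA hne sR ω ≤ RpK κ hA hne j ω := hminR (show j ∈ Icc (0 : ℝ≥0) t from ⟨bot_le, hj⟩)
      have hR0 : 0 ≤ RpK κ hA hne j ω := RFnK_nonneg (κ := κ) (hA := hA) (hne := hne) j (brownianCPath ω)
      have hk1 : (1 : ℝ) ≤ (k + 1 : ℕ) := by exact_mod_cast Nat.succ_pos k
      have e3 : RpK κ hA hne j ω ≤ ((k + 1 : ℕ) : ℝ) * RpK κ hA hne j ω := by nlinarith
      have hm1 := min_le_left (RpK κ hA hne sR ω) (starDeriv (slidHull W A sd))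
      have hm2 := min_le_right (RpK κ hA hne sR ω) (starDeriv (slidHull W A sd))
      rcases min_cases (starDeriv (slidHull W A j)) (((k + 1 : ℕ) : ℝ) * RpK κ hA hne j ω) with ⟨h, -⟩ | ⟨h, -⟩
      · rw [h] at hjs; linarith
      · rw [h] at hjs; linarith
  · have : (t : ℝ) ≥ k + 1 := by
      have h' : ((k : ℝ≥0) + 1 : ℝ≥0) ≤ t := by exact_mod_cast h3
      exact_mod_cast h'
    linarith

/-! ### The a.s. Cauchy property at the terminal time -/

/-- **The nested stopped processes `Y^{T_{k+k₀}}` are a.s. uniformly Cauchy** (martingale convergence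
in the form of `Process.ae_nested_stoppedProcess_cauchy`). [cite: LawlerSchrammWerner2003Restriction, proofs of Thm. 6.1/6.5] -/
theorem ae_cauchy_stoppedProcess_YprocK (hκ0 : 0 < κ) (hκ : κ ≤ 8 / 3) (hαdef : α = (6 - κ) / (2 * κ))
    (hlamdef : lam = (8 - 3 * κ) * (6 - κ) / (2 * κ)) {k₀ : ℕ}
    (hk₀ : ∀ k, k₀ ≤ k → ∀ ω, (0 : WithTop ℝ≥0) < locTimeK κ hA hne k ω) :
    ∀ᵐ ω ∂preWienerMeasure, ∀ ε : ℝ, 0 < ε → ∃ K : ℕ, ∀ k, K ≤ k → ∀ J, k ≤ J → ∀ r : ℝ≥0,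
      |stoppedProcess (YprocK κ α lam A) (locTimeK κ hA hne (J + k₀)) r ω -
        stoppedProcess (YprocK κ α lam A) (locTimeK κ hA hne (k + k₀)) r ω| ≤ ε := by
  haveI := isProbabilityMeasure_preWienerMeasure'
  obtain ⟨hαpos, hlam0⟩ := exponents_pos hκ hαdef hlamdef hκ0
  have hpos : ∀ k ω, (0 : WithTop ℝ≥0) < locTimeK κ hA hne (k + k₀) ω := fun k ω ↦ hk₀ _ le_add_self ω
  exact Process.ae_nested_stoppedProcess_cauchy (τ := fun k ω ↦ locTimeK κ hA hne (k + k₀) ω)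
    (fun ω k J hkJ ↦ monotone_locTimeK ω (by omega)) (fun k ↦ (isStoppingTime_locTimeK (k + k₀)).isOptionalTime)
    (fun k ↦ (martingale_stoppedProcess_YprocK hκ0 hκ hαdef hlamdef (hpos k)).1) (fun t ω ↦ abs_YprocK_le hA hαpos hlam0 t ω)
    (fun k ↦ ae_of_all _ (martingale_stoppedProcess_YprocK hκ0 hκ hαdef hlamdef (hpos k)).2)

/-! ### The limit process -/

variable (κ α lam hA hne) in
/-- **The compensated restriction martingale** `Ȳ_t = limsup_k M^{k+k₀}_t` (the a.s. limit of the
localised martingales; `= Y_t` before the death time, frozen afterwards).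
[cite: LawlerSchrammWerner2003Restriction, Prop. 5.3 and proofs of Thm. 6.1/6.5] -/
def YbarK (k₀ : ℕ) (t : ℝ≥0) (ω : ℝ≥0 → ℝ) : ℝ := limsup (fun k ↦ locMartK κ α lam hA hne (k + k₀) t ω) atTop

/-- `Ȳ` is strongly adapted. [folklore] -/
theorem stronglyAdapted_YbarK (hα : 0 < α) (k₀ : ℕ) : StronglyAdapted brownianFiltration (YbarK κ α lam hA hne k₀) := fun t ↦
  (measurable_limsup_real fun k ↦ ((stronglyAdapted_locMartK (κ := κ) (lam := lam) (hA := hA) (hne := hne) (n := k + k₀) hα) t).measurable).stronglyMeasurable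

/-- **A.s., the localised martingales converge to `Ȳ` at every time.** [folklore] -/
theorem ae_tendsto_locMartK_YbarK (hκ0 : 0 < κ) (hκ : κ ≤ 8 / 3) (hαdef : α = (6 - κ) / (2 * κ))
    (hlamdef : lam = (8 - 3 * κ) * (6 - κ) / (2 * κ)) {k₀ : ℕ}
    (hk₀ : ∀ k, k₀ ≤ k → ∀ ω, (0 : WithTop ℝ≥0) < locTimeK κ hA hne k ω) :
    ∀ᵐ ω ∂preWienerMeasure, ∀ t, Tendsto (fun k ↦ locMartK κ α lam hA hne (k + k₀) t ω) atTop (𝓝 (YbarK κ α lam hA hne k₀ t ω)) := by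
  filter_upwards [ae_cauchy_stoppedProcess_YprocK hκ0 hκ hαdef hlamdef hk₀] with ω hω t
  have hpos : ∀ k ω, (0 : WithTop ℝ≥0) < locTimeK κ hA hne (k + k₀) ω := fun k ω ↦ hk₀ _ le_add_self ω
  have heq : ∀ k, locMartK κ α lam hA hne (k + k₀) t ω = stoppedProcess (YprocK κ α lam A) (locTimeK κ hA hne (k + k₀)) t ω := fun k ↦ by
    rw [stoppedProcess_YprocK_eq_locMartK (hpos k)]
  rw [YbarK]
  simp_rw [heq]
  refine tendsto_limsup_of_cauchy fun ε hε ↦ ?_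
  obtain ⟨K, hK⟩ := hω ε hε
  exact ⟨K, fun k hk J hJ ↦ hK k hk J hJ t⟩

/-- **`Ȳ` is a martingale** (bounded a.s. limit of martingales). [cite: LawlerSchrammWerner2003Restriction, Prop. 5.3] -/
theorem martingale_YbarK (hκ0 : 0 < κ) (hκ : κ ≤ 8 / 3) (hαdef : α = (6 - κ) / (2 * κ))
    (hlamdef : lam = (8 - 3 * κ) * (6 - κ) / (2 * κ)) {k₀ : ℕ}
    (hk₀ : ∀ k, k₀ ≤ k → ∀ ω, (0 : WithTop ℝ≥0) < locTimeK κ hA hne k ω) :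
    Martingale (YbarK κ α lam hA hne k₀) brownianFiltration preWienerMeasure := by
  haveI := isProbabilityMeasure_preWienerMeasure'
  obtain ⟨hαpos, hlam0⟩ := exponents_pos hκ hαdef hlamdef hκ0
  refine Literature.Probability.Process.martingale_of_tendsto_of_abs_le (M := fun k ↦ locMartK κ α lam hA hne (k + k₀))
    (fun k ↦ martingale_locMartK hκ0 hκ hαdef hlamdef)
    (C := fun _ ↦ 1) (fun k t ω ↦ ?_) (fun t ↦ ?_) (stronglyAdapted_YbarK hαpos k₀)
  · rw [abs_of_nonneg (locMartK_mem_Icc hαpos hlam0 t ω).1]; exact (locMartK_mem_Icc hαpos hlam0 t ω).2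
  · filter_upwards [ae_tendsto_locMartK_YbarK hκ0 hκ hαdef hlamdef hk₀] with ω hω
    exact hω t

/-- `0 ≤ Ȳ ≤ 1`. [folklore] -/
theorem YbarK_mem_Icc (hα : 0 < α) (hlam : 0 ≤ lam) (k₀ : ℕ) (t : ℝ≥0) (ω : ℝ≥0 → ℝ) :
    YbarK κ α lam hA hne k₀ t ω ∈ Icc (0 : ℝ) 1 := by
  rw [YbarK]
  have hb1 : ∀ k : ℕ, locMartK κ α lam hA hne (k + k₀) t ω ≤ 1 := fun k ↦ (locMartK_mem_Icc hα hlam t ω).2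
  have hb0 : ∀ k : ℕ, 0 ≤ locMartK κ α lam hA hne (k + k₀) t ω := fun k ↦ (locMartK_mem_Icc hα hlam t ω).1
  have hbdd : IsBoundedUnder (· ≤ ·) atTop fun k : ℕ ↦ locMartK κ α lam hA hne (k + k₀) t ω :=
    ⟨1, eventually_map.2 (Eventually.of_forall hb1)⟩
  have hbddb : IsBoundedUnder (· ≥ ·) atTop fun k : ℕ ↦ locMartK κ α lam hA hne (k + k₀) t ω :=
    ⟨0, eventually_map.2 (Eventually.of_forall hb0)⟩
  have hbdd' : IsCoboundedUnder (· ≤ ·) atTop fun k : ℕ ↦ locMartK κ α lam hA hne (k + k₀) t ω := hbddb.isCoboundedUnder_le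
  constructor
  · exact le_limsup_of_frequently_le (Frequently.of_forall hb0) hbdd
  · exact limsup_le_of_le hbdd' (Eventually.of_forall hb1)

end Nesting

/-! ### Pathwise structure of the limit process -/

section Pathwise

variable {κ : ℝ≥0} {α lam : ℝ} {A : Set ℂ} {hA : IsStarHull A} {hne : A.Nonempty} {k₀ : ℕ}

/-- Stopped values: `Y^{T}_t = Y_t` for `t < T`. [folklore] -/
theorem stoppedProcess_YprocK_apply_of_lt {T : (ℝ≥0 → ℝ) → WithTop ℝ≥0} {t : ℝ≥0} {ω : ℝ≥0 → ℝ}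
    (ht : (t : WithTop ℝ≥0) < T ω) : stoppedProcess (YprocK κ α lam A) T t ω = YprocK κ α lam A t ω := by
  rw [stoppedProcess, min_eq_left ht.le, Process.untopA_coe]

/-- Stopped values after the (finite) stopping time: `Y^{T}_t = Y_T` for `T ≤ t`. [folklore] -/
theorem stoppedProcess_YprocK_apply_of_le {T : (ℝ≥0 → ℝ) → WithTop ℝ≥0} {t τ : ℝ≥0} {ω : ℝ≥0 → ℝ}
    (hT : T ω = τ) (ht : τ ≤ t) : stoppedProcess (YprocK κ α lam A) T t ω = YprocK κ α lam A τ ω := by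
  rw [stoppedProcess, hT, min_eq_right (WithTop.coe_le_coe.2 ht), Process.untopA_coe]

/-- **While alive, `Ȳ_t = Y_t`** (the localised martingales are eventually constant in `k`). [folklore] -/
theorem YbarK_eq_YprocK_of_disjoint (hk₀ : ∀ k, k₀ ≤ k → ∀ ω, (0 : WithTop ℝ≥0) < locTimeK κ hA hne k ω)
    {t : ℝ≥0} {ω : ℝ≥0 → ℝ} (halive : Disjoint (closedHull (drvK κ (brownianCPath ω)) t) A) :
    YbarK κ α lam hA hne k₀ t ω = YprocK κ α lam A t ω := by
  obtain ⟨k, hk⟩ := (disjoint_closedHull_iff_exists_lt_locTimeK (κ := κ) (hA := hA) (hne := hne) t ω).1 halive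
  have hev : ∀ᶠ j in atTop, locMartK κ α lam hA hne (j + k₀) t ω = YprocK κ α lam A t ω := by
    filter_upwards [eventually_ge_atTop k] with j hj
    have hlt : (t : WithTop ℝ≥0) < locTimeK κ hA hne (j + k₀) ω := hk.trans_le (monotone_locTimeK ω (by omega))
    rw [← stoppedProcess_YprocK_eq_locMartK (hk₀ _ le_add_self), stoppedProcess_YprocK_apply_of_lt hlt]
  rw [YbarK]
  exact (tendsto_const_nhds.congr' (EventuallyEq.symm hev)).limsup_eq

/-- A dead time bounds every localising time. [folklore] -/
theorem locTimeK_le_of_not_disjoint {t : ℝ≥0} {ω : ℝ≥0 → ℝ} (hdead : ¬ Disjoint (closedHull (drvK κ (brownianCPath ω)) t) A)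
    (k : ℕ) : locTimeK κ hA hne k ω ≤ (t : WithTop ℝ≥0) := by
  by_contra h
  exact hdead (controlled_of_lt_locTimeK (not_le.1 h)).1

/-- **On the a.s. Cauchy event, `Ȳ` is frozen at the terminal time**: there is `L` with `Ȳ_t = L`
at every dead time `t`, `Ȳ_s → L` as `s ↗ τ` at the first dead time `τ`, and — if no time is
dead — `Ȳ_t` converges as `t → ∞`. [cite: LawlerSchrammWerner2003Restriction, proofs of Thm. 6.1/6.5] -/
theorem exists_frozen_of_cauchyK (hk₀ : ∀ k, k₀ ≤ k → ∀ ω, (0 : WithTop ℝ≥0) < locTimeK κ hA hne k ω) {ω : ℝ≥0 → ℝ}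
    (hω : ∀ ε : ℝ, 0 < ε → ∃ K : ℕ, ∀ k, K ≤ k → ∀ J, k ≤ J → ∀ r : ℝ≥0,
      |stoppedProcess (YprocK κ α lam A) (locTimeK κ hA hne (J + k₀)) r ω -
        stoppedProcess (YprocK κ α lam A) (locTimeK κ hA hne (k + k₀)) r ω| ≤ ε) :
    (∀ τ : ℝ≥0, (∀ s, s < τ → Disjoint (closedHull (drvK κ (brownianCPath ω)) s) A) →
        ¬ Disjoint (closedHull (drvK κ (brownianCPath ω)) τ) A →
        ∃ L : ℝ, (∀ t, τ ≤ t → YbarK κ α lam hA hne k₀ t ω = L) ∧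
          Tendsto (fun s ↦ YbarK κ α lam hA hne k₀ s ω) (𝓝[<] τ) (𝓝 L)) ∧
      ((∀ t, Disjoint (closedHull (drvK κ (brownianCPath ω)) t) A) →
        ∃ c : ℝ, Tendsto (fun t ↦ YbarK κ α lam hA hne k₀ t ω) atTop (𝓝 c)) := by
  have hpos : ∀ k, (0 : WithTop ℝ≥0) < locTimeK κ hA hne (k + k₀) ω := fun k ↦ hk₀ _ le_add_self ω
  have hfin : ∀ k, locTimeK κ hA hne (k + k₀) ω ≠ ⊤ := fun k ↦
    ne_top_of_le_ne_top WithTop.coe_ne_top (locTimeK_le (k + k₀) ω)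
  set σ : ℕ → ℝ≥0 := fun k ↦ (locTimeK κ hA hne (k + k₀) ω).untop (hfin k) with hσ
  have hσeq : ∀ k, locTimeK κ hA hne (k + k₀) ω = σ k := fun k ↦ (WithTop.coe_untop _ (hfin k)).symm
  have hσalive : ∀ k, Disjoint (closedHull (drvK κ (brownianCPath ω)) (σ k)) A := fun k ↦
    (controlled_of_le_locTimeK (κ := κ) (hA := hA) (hne := hne) (t := σ k) (by rw [hσeq]) (hpos k)).1
  set y : ℕ → ℝ := fun k ↦ YprocK κ α lam A (σ k) ω with hy
  have hstop_ge : ∀ k (r : ℝ≥0), σ k ≤ r → stoppedProcess (YprocK κ α lam A) (locTimeK κ hA hne (k + k₀)) r ω = y k :=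
    fun k r hr ↦ stoppedProcess_YprocK_apply_of_le (hσeq k) hr
  have hycauchy : ∀ ε : ℝ, 0 < ε → ∃ K, ∀ k, K ≤ k → ∀ J, k ≤ J → |y J - y k| ≤ ε := by
    intro ε hε
    obtain ⟨K, hK⟩ := hω ε hε
    refine ⟨K, fun k hk J hJ ↦ ?_⟩
    have hmono : σ k ≤ σ J := by
      have h1 : locTimeK κ hA hne (k + k₀) ω ≤ locTimeK κ hA hne (J + k₀) ω := monotone_locTimeK ω (show k + k₀ ≤ J + k₀ by omega)
      rw [hσeq, hσeq] at h1; exact_mod_cast h1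
    have := hK k hk J hJ (σ J)
    rwa [hstop_ge J (σ J) le_rfl, hstop_ge k (σ J) hmono] at this
  obtain ⟨L, hL⟩ : ∃ L, Tendsto y atTop (𝓝 L) := by
    refine cauchySeq_tendsto_of_complete (Metric.cauchySeq_iff'.2 fun ε hε ↦ ?_)
    obtain ⟨K, hK⟩ := hycauchy (ε / 2) (by positivity)
    exact ⟨K, fun J hJ ↦ by rw [Real.dist_eq]; exact lt_of_le_of_lt (hK K le_rfl J hJ) (by linarith)⟩
  have hLy : ∀ ε : ℝ, 0 < ε → ∃ K, ∀ k, K ≤ k → |L - y k| ≤ ε := fun ε hε ↦ by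
    obtain ⟨K, hK⟩ := hycauchy ε hε
    refine ⟨K, fun k hk ↦ ?_⟩
    have : Tendsto (fun J ↦ |y J - y k|) atTop (𝓝 |L - y k|) := ((hL.sub tendsto_const_nhds).abs)
    exact le_of_tendsto this (eventually_atTop.2 ⟨k, fun J hJ ↦ hK k hk J hJ⟩)
  constructor
  · intro τ hbefore hdead
    have hσlt : ∀ k, σ k < τ := fun k ↦ by
      have h1 : ((σ k : ℝ≥0) : WithTop ℝ≥0) ≤ τ := by rw [← hσeq]; exact locTimeK_le_of_not_disjoint hdead _
      rcases (WithTop.coe_le_coe.1 h1).eq_or_lt with h | h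
      · exact absurd (h ▸ hσalive k) hdead
      · exact h
    have hdeadval : ∀ t, τ ≤ t → YbarK κ α lam hA hne k₀ t ω = L := by
      intro t ht
      have hev : ∀ k, locMartK κ α lam hA hne (k + k₀) t ω = y k := fun k ↦ by
        rw [← stoppedProcess_YprocK_eq_locMartK (hk₀ (k + k₀) le_add_self)]
        exact hstop_ge k t ((hσlt k).le.trans ht)
      rw [YbarK]; simp_rw [hev]
      exact hL.limsup_eq
    refine ⟨L, hdeadval, ?_⟩
    rw [Metric.tendsto_nhdsWithin_nhds]
    intro ε hε
    obtain ⟨K, hK⟩ := hω (ε / 3) (by positivity)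
    obtain ⟨K', hK'⟩ := hLy (ε / 3) (by positivity)
    set k := max K K' with hk
    have hσk : (σ k : ℝ) < τ := by exact_mod_cast hσlt k
    refine ⟨(τ : ℝ) - σ k, by linarith, fun s hs hds ↦ ?_⟩
    have hsτ : s < τ := hs
    have hsτ' : (s : ℝ) ≤ τ := by exact_mod_cast hsτ.le
    have hσs : σ k ≤ s := by
      rw [NNReal.dist_eq, abs_sub_comm, abs_of_nonneg (by linarith)] at hds
      have : (σ k : ℝ) ≤ s := by linarith
      exact_mod_cast this
    have halive := hbefore s hsτ
    obtain ⟨j, hj⟩ := (disjoint_closedHull_iff_exists_lt_locTimeK (κ := κ) (hA := hA) (hne := hne) s ω).1 halive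
    set J := max j k with hJ
    have hJs : (s : WithTop ℝ≥0) < locTimeK κ hA hne (J + k₀) ω := hj.trans_le (monotone_locTimeK ω (by omega))
    have h1 := hK k (le_max_left _ _) J (le_max_right _ _) s
    rw [stoppedProcess_YprocK_apply_of_lt hJs, hstop_ge k s hσs] at h1
    have h2 := hK' k (le_max_right _ _)
    rw [Real.dist_eq, YbarK_eq_YprocK_of_disjoint hk₀ halive]
    have : |YprocK κ α lam A s ω - L| ≤ |YprocK κ α lam A s ω - y k| + |L - y k| := by
      have := abs_sub_le (YprocK κ α lam A s ω) (y k) L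
      rw [abs_sub_comm (y k) L] at this; exact this
    linarith
  · intro hall
    refine ⟨L, Metric.tendsto_atTop.2 fun ε hε ↦ ?_⟩
    obtain ⟨K, hK⟩ := hω (ε / 3) (by positivity)
    obtain ⟨K', hK'⟩ := hLy (ε / 3) (by positivity)
    set k := max K K' with hk
    refine ⟨σ k, fun r hr ↦ ?_⟩
    obtain ⟨j, hj⟩ := (disjoint_closedHull_iff_exists_lt_locTimeK (κ := κ) (hA := hA) (hne := hne) r ω).1 (hall r)
    set J := max j k with hJ
    have hJr : (r : WithTop ℝ≥0) < locTimeK κ hA hne (J + k₀) ω := hj.trans_le (monotone_locTimeK ω (by omega))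
    have h1 := hK k (le_max_left _ _) J (le_max_right _ _) r
    rw [stoppedProcess_YprocK_apply_of_lt hJr, hstop_ge k r hr] at h1
    have h2 := hK' k (le_max_right _ _)
    rw [Real.dist_eq, YbarK_eq_YprocK_of_disjoint hk₀ (hall r)]
    have : |YprocK κ α lam A r ω - L| ≤ |YprocK κ α lam A r ω - y k| + |L - y k| := by
      have := abs_sub_le (YprocK κ α lam A r ω) (y k) L
      rw [abs_sub_comm (y k) L] at this; exact this
    linarith

end Pathwise

/-! ### The compensator as a monotone `[0, ∞]`-valued family -/

section Compensator

variable {κ : ℝ≥0} {lam : ℝ} {A : Set ℂ}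

variable (κ) in
/-- **The compensator `L_t = ∫⁻_{(0, t]} 𝟙{alive} m(A_s − W_s) ds ∈ [0, ∞]`**, monotone in `t` for every
path (the integrated Schwarzian mass; finite before the death time).
[cite: LawlerSchrammWerner2003Restriction, Prop. 5.3 and Thm. 6.5 (∫ Sh_s(W_s)/6 ds)] -/
def LpK (A : Set ℂ) (t : ℝ≥0) (ω : ℝ≥0 → ℝ) : ℝ≥0∞ := ∫⁻ s in Ioc (0 : ℝ) t, ENNReal.ofReal (MpK κ A s.toNNReal ω)

/-- `L_0 = 0`. [folklore] -/
theorem LpK_zero (ω : ℝ≥0 → ℝ) : LpK κ A 0 ω = 0 := by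
  simp [LpK]

/-- `t ↦ L_t` is monotone. [folklore] -/
theorem LpK_mono (ω : ℝ≥0 → ℝ) : Monotone fun t ↦ LpK κ A t ω := fun _ _ hst ↦
  lintegral_mono_set (Ioc_subset_Ioc_right (NNReal.coe_le_coe.2 hst))

/-- **While alive, `L_t = ∫₀ᵗ m < ∞` and `e^{−λ I_t} = compFactor (λ L_t)`.** [folklore] -/
theorem compFactor_LpK_eq_of_disjoint (hA : IsStarHull A) (hne : A.Nonempty) (hlam : 0 ≤ lam) {t : ℝ≥0} {ω : ℝ≥0 → ℝ}
    (halive : Disjoint (closedHull (drvK κ (brownianCPath ω)) t) A) :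
    LpK κ A t ω = ENNReal.ofReal (IpK κ A t ω) ∧
      compFactor (ENNReal.ofReal lam * LpK κ A t ω) = Real.exp (-(lam * IpK κ A t ω)) := by
  obtain ⟨k, hk⟩ := (disjoint_closedHull_iff_exists_lt_locTimeK (κ := κ) (hA := hA) (hne := hne) t ω).1 halive
  set f : ℝ → ℝ := fun s ↦ MpK κ A s.toNNReal ω with hf
  have hfm : Measurable f := (measurable_MpK_path hA hne ω).comp measurable_real_toNNReal
  have hf0 : ∀ s, 0 ≤ f s := fun s ↦ MpK_nonneg hA _ ω
  have hfb : ∀ s ∈ Ioc (0 : ℝ) t, f s ≤ massBdK (locLevel k) := fun s hs ↦ by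
    have hst : ((s.toNNReal : ℝ≥0) : WithTop ℝ≥0) < locTimeK κ hA hne k ω :=
      lt_of_le_of_lt (WithTop.coe_le_coe.2 (Real.toNNReal_le_iff_le_coe.2 hs.2)) hk
    exact MpK_le_massBdK_of_lt_locTimeK hst
  have hfi : IntegrableOn f (Ioc (0 : ℝ) t) := by
    refine Measure.integrableOn_of_bounded (M := massBdK (locLevel k)) measure_Ioc_lt_top.ne hfm.aestronglyMeasurable ?_
    filter_upwards [ae_restrict_mem measurableSet_Ioc] with s hs
    rw [Real.norm_eq_abs, abs_of_nonneg (hf0 s)]; exact hfb s hs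
  have hI : IpK κ A t ω = ∫ s in Ioc (0 : ℝ) t, f s := intervalIntegral.integral_of_le t.coe_nonneg
  have hL : LpK κ A t ω = ENNReal.ofReal (IpK κ A t ω) := by
    rw [hI, ofReal_integral_eq_lintegral_ofReal hfi (Eventually.of_forall fun s ↦ hf0 s)]
    rfl
  refine ⟨hL, ?_⟩
  have hI0 : 0 ≤ IpK κ A t ω := IpK_nonneg hA t ω
  rw [hL, ← ENNReal.ofReal_mul hlam, compFactor_of_ne_top ENNReal.ofReal_ne_top, ENNReal.toReal_ofReal (mul_nonneg hlam hI0)]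

/-- For the empty hull the compensator vanishes. [folklore] -/
theorem LpK_empty (κ : ℝ≥0) : LpK κ (∅ : Set ℂ) = fun _ _ ↦ 0 := by
  funext t ω
  have h0 : ∀ s : ℝ≥0, MpK κ (∅ : Set ℂ) s ω = 0 := fun s ↦ by
    rw [MpK, MFnK]
    by_cases h : brownianCPath ω ∈ {υ : C(ℝ≥0, ℝ) | Disjoint (closedHull (drvK κ υ) s) ∅}
    · rw [Set.indicator_of_mem h, Loewner.slidHull_empty, starBubbleMass_empty]
    · rw [Set.indicator_of_notMem h]
  simp [LpK, h0]

end Compensator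

/-! ### The compensated restriction martingale exists -/

/-- **[LSW] Prop. 5.3 (`0 < κ ≤ 8/3`): the compensated restriction martingale of a nonempty `*`-hull**,
from the Rohde–Schramm trace facts. [cite: LawlerSchrammWerner2003Restriction, Prop. 5.3 and proofs of Thm. 6.1/6.5] -/
theorem isRestrictionMartingaleK_YbarK {κ : ℝ≥0} {α lam : ℝ} (hκ0 : 0 < κ) (hκ : κ ≤ 8 / 3)
    (hαdef : α = (6 - κ) / (2 * κ)) (hlamdef : lam = (8 - 3 * κ) * (6 - κ) / (2 * κ))
    {A : Set ℂ} (hA : IsStarHull A) (hne : A.Nonempty) {k₀ : ℕ}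
    (hk₀ : ∀ k, k₀ ≤ k → ∀ ω, (0 : WithTop ℝ≥0) < locTimeK κ hA hne k ω)
    (hgen : HasSLETrace κ) (hsimple : ∀ᵐ ω ∂preWienerMeasure, IsSimpleTrace (sleTrace κ ω)) :
    IsRestrictionMartingaleK κ α lam A (LpK κ A) (YbarK κ α lam hA hne k₀) := by
  obtain ⟨hαpos, hlam0⟩ := exponents_pos hκ hαdef hlamdef hκ0
  have hdrv : ∀ ω, drvK κ (brownianCPath ω) = sleDriving κ ω := fun ω ↦ drvK_brownianCPath κ ω
  have hident : ∀ᵐ ω ∂preWienerMeasure, ∀ t, Disjoint (closedHull (drvK κ (brownianCPath ω)) t) A ↔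
      (t : WithTop ℝ≥0) < firstHit (sleTrace κ ω) A := by
    filter_upwards [ae_isGeneratedByCurve_sleTrace hgen, hsimple] with ω hg hs t
    rw [hdrv]
    exact disjoint_closedHull_iff_lt_firstHit (continuous_sleDriving _ ω) (sleDriving_zero _ ω) hg hs hA t
  refine ⟨fun t ω ↦ YbarK_mem_Icc hαpos hlam0 k₀ t ω, martingale_YbarK hκ0 hκ hαdef hlamdef hk₀, LpK_zero, LpK_mono, ?_, ?_, ?_⟩
  · filter_upwards [hident] with ω hω t ht
    have halive := (hω t).2 ht
    have hB : IsStarHull (slidHull (sleDriving κ ω) A t) := by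
      rw [← hdrv]; exact Loewner.isStarHull_slidHull_of_disjoint (continuous_drvK κ _) hA halive
    obtain ⟨hd0, hd1, hd⟩ := starDeriv_spec hB
    refine ⟨starRMap _ hB, starDeriv (slidHull (sleDriving κ ω) A t), isRestrictionMap_starRMap hB, hd, hd0, hd1, ?_⟩
    rw [YbarK_eq_YprocK_of_disjoint hk₀ halive, YprocK, (DFnK_eq (κ := κ) (A := A) t (brownianCPath ω)).1 halive, hdrv,
      (compFactor_LpK_eq_of_disjoint hA hne hlam0 halive).2]
  · filter_upwards [hident, ae_cauchy_stoppedProcess_YprocK hκ0 hκ hαdef hlamdef hk₀] with ω hω hcauchy τ hτ t hτt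
    have hbefore : ∀ s, s < τ → Disjoint (closedHull (drvK κ (brownianCPath ω)) s) A := fun s hs ↦
      (hω s).2 (by rw [hτ]; exact_mod_cast hs)
    have hdead : ¬ Disjoint (closedHull (drvK κ (brownianCPath ω)) τ) A := fun h ↦ by
      have := (hω τ).1 h; rw [hτ] at this; exact lt_irrefl _ this
    obtain ⟨L, hL, hlim⟩ := (exists_frozen_of_cauchyK hk₀ hcauchy).1 τ hbefore hdead
    rw [hL t hτt]; exact hlim
  · filter_upwards [hident, ae_cauchy_stoppedProcess_YprocK hκ0 hκ hαdef hlamdef hk₀] with ω hω hcauchy htop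
    exact (exists_frozen_of_cauchyK hk₀ hcauchy).2 fun t ↦ (hω t).2 (by rw [htop]; exact WithTop.coe_lt_top t)

/-- **[LSW] Prop. 5.3 for every `0 < κ ≤ 8/3` and `A ∈ 𝒬*`: a compensated restriction martingale with
compensator `LpK κ A` exists** (the SLE_κ chain being a.s. generated by a simple curve, Rohde–Schramm
Thm 5.1 and Thm 6.1, both theorems of the tree).
[cite: LawlerSchrammWerner2003Restriction, Prop. 5.3 and proofs of Thm. 6.1/6.5] -/
theorem exists_isRestrictionMartingaleK {κ : ℝ≥0} {α lam : ℝ} (hκ0 : 0 < κ) (hκ : κ ≤ 8 / 3)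
    (hαdef : α = (6 - κ) / (2 * κ)) (hlamdef : lam = (8 - 3 * κ) * (6 - κ) / (2 * κ))
    {A : Set ℂ} (hA : IsStarHull A) : ∃ Y, IsRestrictionMartingaleK κ α lam A (LpK κ A) Y := by
  rcases A.eq_empty_or_nonempty with rfl | hne
  · rw [LpK_empty]
    exact ⟨fun _ _ ↦ 1, isRestrictionMartingaleK_empty κ α lam⟩
  · obtain ⟨k₀, hk₀⟩ := exists_forall_locTimeK_pos (κ := κ) hA hne
    have hκ8 : κ ≠ 8 := by
      intro h
      have h' : ((κ : ℝ≥0) : ℝ) ≤ 8 / 3 := by exact_mod_cast hκ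
      rw [h] at h'; norm_num at h'
    have hκ4 : κ ≤ 4 := hκ.trans (by rw [div_le_iff₀ (by norm_num : (0 : ℝ≥0) < 3)]; norm_num)
    exact ⟨YbarK κ α lam hA hne k₀, isRestrictionMartingaleK_YbarK hκ0 hκ hαdef hlamdef hA hne hk₀
      (hasSLETrace_of_ne_eight_holds hκ8)
      (ae_isSimpleTrace_sleTrace_of_le_four_of_hasSLETrace_fact hasSLETrace_of_ne_eight_holds hκ0 hκ4)⟩

end Literature.Probability.RandomPlanarGeometry

end
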